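import Literature.NumberTheory.Automorphic.PrincipalSeriesGL2WeylSymmetry
import Literature.NumberTheory.Automorphic.Zelevinsky1980.InducedCharacterRigidity
import HarnessLib

/-!
# The isomorphism classes of the unitary principal series of `GL₂(F)`: `i(ν₁ ⊠ χ₁) ≅ i(ν₂ ⊠ χ₂)` iff `(ν₂, χ₂) ∈ {(ν₁, χ₁), (χ₁, ν₁)}`

Topic `NumberTheory/Automorphic` (namespace `Literature.NumberTheory.Automorphic.Zelevinsky1980`); THEOREMS ONLY (no definition, no named
fact, no `sorry`, no instance, no notation).  `F` a non-archimedean local field with `q_F = #𝓀_F`, `P = Q_{1,1} ≤ GL₂(F)` the Borel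
subgroup, `i(ν ⊠ χ′) = Representation.parabolicIndGL F (lastBlockLabel 2) (𝟙.twist (maxParabolicLeviChar F 2 ν χ′)) = Ind_P σ'_{ν,χ′}` the
normalised principal series (★ `DetCharInducingDatum`).

[BernsteinZelevinsky1977, Thm. 2.9] ∕ [Zelevinsky1980, Thm. 4.2 with Thm. 6.1]: two irreducible principal series are isomorphic iff their inducing
data have the same cuspidal support, i.e. coincide up to the Weyl group.  For `GL₂` and UNITARY continuous characters:

* `ne_of_detCharDatum_cross_two` — the MIXED exponents `q_F σ'_{ν₁,χ₁}(d₀(ϖ)) = ν₁(ϖ) √q_F` and `σ'_{ν₂,χ₂}(d(ϖ)) = χ₂(ϖ) √q_F` differ iff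
  `ν₁(ϖ) ≠ χ₂(ϖ)` (★ `residueFieldCard_mul_detCharDatum_diag_zero_uniformizer`, ★ `detCharDatum_diag_last_uniformizer` at `n = 0`);
* `eq_of_areIsomorphicRep_parabolicIndGL_two_of_ne` — **rigidity at `N = 2` off the Weyl-conjugate datum**: if `i(ν₁ ⊠ χ₁) ≅ i(ν₂ ⊠ χ₂)` and
  `ν₁ ≠ χ₂` then `(ν₁, χ₁) = (ν₂, χ₂)` (★ `eq_of_intertwiningMap_ne_zero` — the Bruhat filtration of `Ind σ'₁|_P` — at a uniformizer separating
  `ν₁` from `χ₂`, ★ `exists_isUniformizingElement_map_ne`; continuity of `ν₁, χ₁` only, no unitarity) — the `N = 2` complement of ★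
  `eq_of_areIsomorphicRep_parabolicIndGL_detChar (hn : 1 ≤ n)`;
* **`areIsomorphicRep_parabolicIndGL_two_iff`** — for unitary continuous `ν₁, χ₁, ν₂, χ₂`:
  `i(ν₁ ⊠ χ₁) ≅ i(ν₂ ⊠ χ₂) ↔ (ν₁ = ν₂ ∧ χ₁ = χ₂) ∨ (ν₁ = χ₂ ∧ χ₁ = ν₂)`; «⇐» is `refl` ∕ the Weyl symmetry ★
  `areIsomorphicRep_parabolicIndGL_two_swap` (`PrincipalSeriesGL2WeylSymmetry`).

Consumer (cell hodgecm-mathlib, crux `HLiu418`, P5): the «only if» direction of [Liu2021, Lem. D.1 (4)] at a SPLIT place for `n = 2` (two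
θ-package local factors at a split place are isomorphic only if their split data coincide up to the swap `(ν, χν⁻¹) ↦ (χν⁻¹, ν)`).

## References
* [BernsteinZelevinsky1977] I. N. Bernstein, A. V. Zelevinsky, *Induced representations of reductive `p`-adic groups. I*, Ann. Sci. ÉNS 10
  (1977), Thm. 2.9, Thm. 5.2, §7.1.
* [Zelevinsky1980] A. V. Zelevinsky, *Induced representations of reductive `p`-adic groups. II*, Ann. Sci. ÉNS 13 (1980), Thm. 4.2, Thm. 6.1.
* [Bump1997] D. Bump, *Automorphic forms and representations* (1997), Thm. 4.5.3.
-/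

set_option autoImplicit false

noncomputable section

open Matrix Literature.LinearAlgebra.Matrix.DiagonalTorus
open scoped NNReal

namespace Literature.NumberTheory.Automorphic.Zelevinsky1980

open Literature.NumberTheory.Automorphic ValuativeRel

universe u

variable (F : Type u) [Field F] [ValuativeRel F] [TopologicalSpace F] [IsNonarchimedeanLocalField F] (ν₁ χ₁ ν₂ χ₂ : Fˣ →* ℂˣ)

/-- **The mixed exponents at `N = 2` differ iff `ν₁(ϖ) ≠ χ₂(ϖ)`**: `q_F · σ'_{ν₁,χ₁}(d₀(ϖ)) 1 = ν₁(ϖ) √q_F` (open cell of `Ind σ'₁`) vs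
`σ'_{ν₂,χ₂}(d(ϖ)) 1 = χ₂(ϖ) √q_F` (closed cell of `Ind σ'₂`). [cite: BernsteinZelevinsky1977, §7.1] -/
theorem ne_of_detCharDatum_cross_two {ϖ : F} (hϖ : IsUniformizingElement ϖ)
    (hne : ν₁ (Units.mk0 ϖ hϖ.ne_zero) ≠ χ₂ (Units.mk0 ϖ hϖ.ne_zero)) :
    (GaloisRepresentations.IsNonarchimedeanLocalField.residueFieldCard F : ℂ) * (Representation.twist (((Representation.trivial ℂ (Π a : Bool, GL {i : Fin 2 // lastBlockLabel 2 i = a} F) ℂ).twist (maxParabolicLeviChar F 2 ν₁ χ₁)).comp (leviProjection F (lastBlockLabel 2))) (rootDeltaChar (standardParabolicGL F (lastBlockLabel 2)))) (⟨diagGL (Fin 2) (Function.update 1 0 (Units.mk0 ϖ hϖ.ne_zero)), diagGL_mem_standardParabolicGL _ _⟩ : ↥(standardParabolicGL F (lastBlockLabel 2))) 1 ≠ (Representation.twist (((Representation.trivial ℂ (Π a : Bool, GL {i : Fin 2 // lastBlockLabel 2 i = a} F) ℂ).twist (maxParabolicLeviChar F 2 ν₂ χ₂)).comp (leviProjection F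 (lastBlockLabel 2))) (rootDeltaChar (standardParabolicGL F (lastBlockLabel 2)))) (⟨diagGL (Fin 2) (Function.update 1 (Fin.last 1) (Units.mk0 ϖ hϖ.ne_zero)), diagGL_mem_standardParabolicGL _ _⟩ : ↥(standardParabolicGL F (lastBlockLabel 2))) 1 := by
  rw [residueFieldCard_mul_detCharDatum_diag_zero_uniformizer F (n := 0) ν₁ χ₁ hϖ,
    detCharDatum_diag_last_uniformizer F (n := 0) ν₂ χ₂ hϖ, zero_add, pow_one]
  have hq0 : (0 : ℝ) < (GaloisRepresentations.IsNonarchimedeanLocalField.residueFieldCard F : ℝ) := by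
    exact_mod_cast zero_lt_one.trans (GaloisRepresentations.IsNonarchimedeanLocalField.one_lt_residueFieldCard F)
  have hq : (Real.sqrt (GaloisRepresentations.IsNonarchimedeanLocalField.residueFieldCard F : ℝ) : ℂ) ≠ 0 :=
    Complex.ofReal_ne_zero.2 (Real.sqrt_ne_zero'.2 hq0)
  rw [Ne, mul_left_inj' hq, Units.val_inj]
  exact hne

/-- **Rigidity at `N = 2` off the Weyl-conjugate datum.**  For continuous `ν₁, χ₁` and any `ν₂, χ₂`: if `i(ν₁ ⊠ χ₁) ≅ i(ν₂ ⊠ χ₂)`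
(`Liu2021.AreIsomorphicRep`) and `ν₁ ≠ χ₂`, then `ν₁ = ν₂` and `χ₁ = χ₂` — at a uniformizer `ϖ` with `ν₁(ϖ) ≠ χ₂(ϖ)` the open-cell exponent
of `Ind σ'₁` differs from the closed-cell exponent of `Ind σ'₂`, so every non-zero intertwiner forces `σ'₁ = σ'₂` (★
`eq_of_intertwiningMap_ne_zero`). [cite: Zelevinsky1980, Thm. 4.2 and Thm. 6.1] [cite: BernsteinZelevinsky1977, Thm. 2.9 and §7.1] -/
theorem eq_of_areIsomorphicRep_parabolicIndGL_two_of_ne [LocallyCompactSpace (standardParabolicGL F (lastBlockLabel 2))]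
    (hν₁c : Continuous fun x => ((ν₁ x : ℂˣ) : ℂ)) (hχ₁c : Continuous fun x => ((χ₁ x : ℂˣ) : ℂ))
    (h : Liu2021.AreIsomorphicRep (Representation.parabolicIndGL F (lastBlockLabel 2) ((Representation.trivial ℂ (Π a : Bool, GL {i : Fin 2 // lastBlockLabel 2 i = a} F) ℂ).twist (maxParabolicLeviChar F 2 ν₁ χ₁))) (Representation.parabolicIndGL F (lastBlockLabel 2) ((Representation.trivial ℂ (Π a : Bool, GL {i : Fin 2 // lastBlockLabel 2 i = a} F) ℂ).twist (maxParabolicLeviChar F 2 ν₂ χ₂)))) (hne : ν₁ ≠ χ₂) :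
    ν₁ = ν₂ ∧ χ₁ = χ₂ := by
  classical
  obtain ⟨ϖ, hϖ, hsep⟩ := exists_isUniformizingElement_map_ne hne
  obtain ⟨e⟩ := h.nonempty_equiv
  haveI := nontrivial_parabolicIndGL_detChar F 2 ν₁ χ₁ hν₁c hχ₁c
  obtain ⟨f, hf⟩ := exists_ne (0 : Representation.SmoothInd (standardParabolicGL F (lastBlockLabel 2)) (Representation.twist (((Representation.trivial ℂ (Π a : Bool, GL {i : Fin 2 // lastBlockLabel 2 i = a} F) ℂ).twist (maxParabolicLeviChar F 2 ν₁ χ₁)).comp (leviProjection F (lastBlockLabel 2))) (rootDeltaChar (standardParabolicGL F (lastBlockLabel 2)))))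
  refine eq_of_detCharDatum_eq F (n := 0) ν₁ χ₁ ν₂ χ₂
    (eq_of_intertwiningMap_ne_zero _ _ (detCharDatum_isSmooth F 2 ν₁ χ₁ hν₁c hχ₁c)
      (fun u hu => detCharDatum_eq_one_of_mem_unipotentRadicalP F 2 ν₂ χ₂ u hu) hϖ
      (ne_of_detCharDatum_cross_two F ν₁ χ₁ ν₂ χ₂ hϖ hsep) e.toIntertwiningMap ⟨f, fun h0 => hf ?_⟩)
  have : e.toLinearEquiv f = 0 := h0
  exact e.toLinearEquiv.map_eq_zero_iff.1 this

/-- **THE ISOMORPHISM CLASSES OF THE UNITARY PRINCIPAL SERIES OF `GL₂(F)`** ([BernsteinZelevinsky1977, Thm. 2.9]; [Zelevinsky1980, Thm. 4.2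
with Thm. 6.1]; [Bump1997, Thm. 4.5.3]): for UNITARY CONTINUOUS characters `ν₁, χ₁, ν₂, χ₂` of `Fˣ`,
`i(ν₁ ⊠ χ₁) ≅ i(ν₂ ⊠ χ₂)` iff `(ν₂, χ₂) = (ν₁, χ₁)` or `(ν₂, χ₂) = (χ₁, ν₁)` — the inducing datum is determined up to the Weyl group element
`w₀`.  «⇒»: `eq_of_areIsomorphicRep_parabolicIndGL_two_of_ne` applied to `h` (if `ν₁ ≠ χ₂`) or to `h.symm` (if `ν₂ ≠ χ₁`); «⇐»: `refl`, resp.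
the Weyl symmetry ★ `areIsomorphicRep_parabolicIndGL_two_swap`. [cite: BernsteinZelevinsky1977, Thm. 2.9] [cite: Zelevinsky1980, Thm. 4.2 and Thm. 6.1]
[cite: Bump1997, Thm. 4.5.3] -/
theorem areIsomorphicRep_parabolicIndGL_two_iff [LocallyCompactSpace (standardParabolicGL F (lastBlockLabel 2))]
    (hν₁u : ∀ x, ‖((ν₁ x : ℂˣ) : ℂ)‖ = 1) (hν₁c : Continuous fun x => ((ν₁ x : ℂˣ) : ℂ))
    (hχ₁u : ∀ x, ‖((χ₁ x : ℂˣ) : ℂ)‖ = 1) (hχ₁c : Continuous fun x => ((χ₁ x : ℂˣ) : ℂ))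
    (hν₂c : Continuous fun x => ((ν₂ x : ℂˣ) : ℂ)) (hχ₂c : Continuous fun x => ((χ₂ x : ℂˣ) : ℂ)) :
    Liu2021.AreIsomorphicRep (Representation.parabolicIndGL F (lastBlockLabel 2) ((Representation.trivial ℂ (Π a : Bool, GL {i : Fin 2 // lastBlockLabel 2 i = a} F) ℂ).twist (maxParabolicLeviChar F 2 ν₁ χ₁))) (Representation.parabolicIndGL F (lastBlockLabel 2) ((Representation.trivial ℂ (Π a : Bool, GL {i : Fin 2 // lastBlockLabel 2 i = a} F) ℂ).twist (maxParabolicLeviChar F 2 ν₂ χ₂))) ↔ (ν₁ = ν₂ ∧ χ₁ = χ₂) ∨ (ν₁ = χ₂ ∧ χ₁ = ν₂) := by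
  constructor
  · intro h
    by_cases h12 : ν₁ = χ₂
    · by_cases h21 : χ₁ = ν₂
      · exact Or.inr ⟨h12, h21⟩
      · obtain ⟨hν, hχ⟩ := eq_of_areIsomorphicRep_parabolicIndGL_two_of_ne F ν₂ χ₂ ν₁ χ₁ hν₂c hχ₂c h.symm (Ne.symm h21)
        exact Or.inl ⟨hν.symm, hχ.symm⟩
    · exact Or.inl (eq_of_areIsomorphicRep_parabolicIndGL_two_of_ne F ν₁ χ₁ ν₂ χ₂ hν₁c hχ₁c h h12)
  · rintro (⟨rfl, rfl⟩ | ⟨rfl, rfl⟩)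
    · exact Liu2021.AreIsomorphicRep.refl _
    · exact areIsomorphicRep_parabolicIndGL_two_swap ν₁ χ₁ hν₁u hν₁c hχ₁u hχ₁c

end Literature.NumberTheory.Automorphic.Zelevinsky1980

end
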